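import Mathlib
import HarnessLib

/-!
# Ladder generation: a unipotent operator that climbs a finite filtration one step at a time generates the
# module from the bottom rung (pure algebra; the TOWER LEMMA `(T_n)` of the plus `ℤ₂`-tower at `2` in
# abstract form — K4 `SignedControlAtTwo`, stmt-BirchSwinnertonDyer-20309, line `eulerchar`, stub CYC⁺@2/HONDA⁺@2)

Route `ThetaPartnerAtTwo` (TP2; crux shared with `ResidualThetaTransportAtTwo`), crux K4, lead seat
`prover-bsd-wall-tp2-p3` (g2). Memo of record: `Cruxes/SignedControlAtTwo/LAGPLUS-AT-2-CONSTRUCTION.md` §4 (v).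

WHY. In Kobayashi's §8.4 over the FULL cyclotomic tower `ℚ_p(ζ_{p^m})` the generation step
(Prop. 8.11 ⇒ 8.12 ii) needs no lemma about the ring of integers beyond `𝒪 = ℤ_p[ζ]`: the powers `ζ^i`
ARE Galois conjugates of `ζ` or lie in the previous layer (the tree's `zeta_pow_mem_closure_sup`). Over the
PLUS tower `k_n = ℚ₂(ζ_{2^{n+2}})⁺` needed by K4 (the cyclotomic `ℤ₂`-extension of `ℚ₂`) the powers of the
uniformizer `v_n = ζ + ζ⁻¹ − 2` are NOT conjugates, and the generation step needs the TOWER LEMMA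
`(T_n)`: `𝒪_{k_{n−1}} = Σ_i ℤ₂·c_i`, `c_i = ∏_{j<i}(1 + σ^j v_{n−1})` (the `v_n`-coefficients of
`σ^i(v_n)`), kit-certified for `n ≤ 9` (j293539). Its proof (memo §4 (v)) is a Nakayama argument over
`𝔽₂[G_n]`: modulo `2`, `𝒪_{k_{n−1}}/2 = 𝔽₂[v]/(v^e)`, the twisted action `σ⋆a = σ(a)·c_1` satisfies
`(σ⋆ − 1)(v^k) = v^{k+1} + (higher powers)` — a "ladder". THIS FILE proves the abstract ladder statement,
with no number theory: it is the piece of `(T_n)` that is pure algebra.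

WHAT (`Ladder.mem_closure_pow_apply_sup`). Let `A` be an additive commutative group, `φ ∈ End_ℤ(A)`,
`N ≤ A` a `φ`-stable subgroup (think `2·𝒪`), `b : ℕ → A` (think `k ↦ v^k`) and `e : ℕ` with
(top) `b j ∈ N` for `j ≥ e`; (ladder) `φ(b k) − b k − b (k+1) ∈ ⟨b j : j ≥ k+2⟩ + N` for `k < e`;
(span) `A = ⟨b k : k⟩ + N`. Then `A = ⟨φ^i (b 0) : i⟩ + N`. Corollary `Ladder.exists_mem_closure_add_pow_nsmul`:
with `N = p·A`-congruences, `A = ⟨φ^i(b 0)⟩ + p^k·A` for every `k` (Nakayama iteration).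

HONEST FRAMING: THEOREMS ONLY (no definition, no named fact, no `sorry`), route-independent; nothing
about any curve or field is asserted; closes no item; BSD is not proved by any of this.

References: [Kobayashi2003] S. Kobayashi, Invent. Math. 152 (2003), Prop. 8.11–8.12 (the generation
step this abstracts, pp. 17–18); [AtiyahMacdonald1969] Prop. 2.6, Cor. 2.7 (Nakayama); [Washington1997]
§13.1 (the layers `ℚ(ζ_{2^{n+2}})⁺` of the cyclotomic `ℤ₂`-extension).
-/

set_option autoImplicit false
-- the Theorems namespace of this sub repeats the summit name by design (D-0017 nested layout)
set_option linter.dupNamespace false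

noncomputable section

open scoped Classical

namespace Summit.BirchSwinnertonDyer.BirchSwinnertonDyer.Theorems.SignedEC.Ladder

variable {A : Type*} [AddCommGroup A]

/-- The rung filtration `F k = ⟨b j : j ≥ k⟩ + N`. (Local shorthand kept as an explicit expression in
all statements; this lemma: it is antitone in `k`.) [folklore] -/
theorem closure_image_Ici_mono (b : ℕ → A) (N : AddSubgroup A) {k l : ℕ} (h : k ≤ l) :
    AddSubgroup.closure (b '' Set.Ici l) ⊔ N ≤ AddSubgroup.closure (b '' Set.Ici k) ⊔ N :=
  sup_le_sup_right (AddSubgroup.closure_mono (Set.image_mono (Set.Ici_subset_Ici.mpr h))) N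

/-- A rung `b j`, `j ≥ k`, lies in `F k`. [folklore] -/
theorem mem_closure_image_Ici_sup (b : ℕ → A) (N : AddSubgroup A) {k j : ℕ} (h : k ≤ j) :
    b j ∈ AddSubgroup.closure (b '' Set.Ici k) ⊔ N :=
  AddSubgroup.mem_sup_left (AddSubgroup.subset_closure ⟨j, Set.mem_Ici.mpr h, rfl⟩)

/-- **The ladder step maps `F k` into `F (k+1)`**: with `ψ = φ − 1`, if `ψ(b j) ∈ b (j+1) + F (j+2)` for
`j < e`, `b j ∈ N` for `j ≥ e` and `N` is `φ`-stable, then `ψ(F k) ⊆ F (k+1)`. [folklore] -/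
theorem sub_apply_mem_of_mem (φ : Module.End ℤ A) (N : AddSubgroup A) (hN : ∀ x ∈ N, φ x ∈ N)
    (b : ℕ → A) (e : ℕ) (htop : ∀ j, e ≤ j → b j ∈ N)
    (hlad : ∀ k, k < e → φ (b k) - b k - b (k + 1) ∈ AddSubgroup.closure (b '' Set.Ici (k + 2)) ⊔ N)
    (k : ℕ) {x : A} (hx : x ∈ AddSubgroup.closure (b '' Set.Ici k) ⊔ N) :
    φ x - x ∈ AddSubgroup.closure (b '' Set.Ici (k + 1)) ⊔ N := by
  obtain ⟨y, hy, n, hn, rfl⟩ := AddSubgroup.mem_sup.mp hx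
  have hn' : φ n - n ∈ AddSubgroup.closure (b '' Set.Ici (k + 1)) ⊔ N :=
    AddSubgroup.mem_sup_right (N.sub_mem (hN n hn) hn)
  rw [map_add, show φ y + φ n - (y + n) = (φ y - y) + (φ n - n) by abel]
  refine AddSubgroup.add_mem _ ?_ hn'
  -- on the generators `b j`, `j ≥ k`
  refine AddSubgroup.closure_induction (p := fun y _ ↦ φ y - y ∈ AddSubgroup.closure (b '' Set.Ici (k + 1)) ⊔ N)
    ?_ ?_ ?_ ?_ hy
  · rintro _ ⟨j, hj, rfl⟩
    rw [Set.mem_Ici] at hj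
    by_cases hje : j < e
    · have h1 : b (j + 1) ∈ AddSubgroup.closure (b '' Set.Ici (k + 1)) ⊔ N :=
        mem_closure_image_Ici_sup b N (by omega)
      have h2 : φ (b j) - b j - b (j + 1) ∈ AddSubgroup.closure (b '' Set.Ici (k + 1)) ⊔ N :=
        closure_image_Ici_mono b N (by omega) (hlad j hje)
      have := AddSubgroup.add_mem _ h2 h1
      rwa [sub_add_cancel] at this
    · exact AddSubgroup.mem_sup_right (N.sub_mem (hN _ (htop j (by omega))) (htop j (by omega)))
  · rw [map_zero, sub_zero]; exact AddSubgroup.zero_mem _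
  · intro x y _ _ hx hy
    rw [map_add, show φ x + φ y - (x + y) = (φ x - x) + (φ y - y) by abel]
    exact AddSubgroup.add_mem _ hx hy
  · intro x _ hx
    rw [map_neg, show -φ x - -x = -(φ x - x) by abel]
    exact AddSubgroup.neg_mem _ hx

/-- **`(φ − 1)^k (b 0) ∈ b k + F (k+1)`** for `k ≤ e`... precisely for every `k` with `k ≤ e` such that the
ladder hypothesis is available below `k`: here for all `k < e + 1` by induction (the step from `k` to
`k + 1` uses the ladder at `k < e`). [folklore] -/
theorem pow_sub_one_apply_sub_mem (φ : Module.End ℤ A) (N : AddSubgroup A) (hN : ∀ x ∈ N, φ x ∈ N)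
    (b : ℕ → A) (e : ℕ) (htop : ∀ j, e ≤ j → b j ∈ N)
    (hlad : ∀ k, k < e → φ (b k) - b k - b (k + 1) ∈ AddSubgroup.closure (b '' Set.Ici (k + 2)) ⊔ N)
    {k : ℕ} (hk : k ≤ e) :
    ((φ - 1) ^ k) (b 0) - b k ∈ AddSubgroup.closure (b '' Set.Ici (k + 1)) ⊔ N := by
  induction k with
  | zero => rw [pow_zero, Module.End.one_apply, sub_self]; exact AddSubgroup.zero_mem _
  | succ k ih =>
    have hk' : k < e := by omega
    have h1 := ih hk'.le
    -- `ψ^{k+1} b0 = ψ(b k + f)`, `f ∈ F(k+1)`; `ψ(b k) ∈ b(k+1) + F(k+2)`, `ψ(f) ∈ F(k+2)`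
    have hψf : (φ - 1) (((φ - 1) ^ k) (b 0) - b k) ∈ AddSubgroup.closure (b '' Set.Ici (k + 2)) ⊔ N := by
      have := sub_apply_mem_of_mem φ N hN b e htop hlad (k + 1) h1
      rwa [LinearMap.sub_apply, Module.End.one_apply]
    have hψb : (φ - 1) (b k) - b (k + 1) ∈ AddSubgroup.closure (b '' Set.Ici (k + 2)) ⊔ N := by
      rw [LinearMap.sub_apply, Module.End.one_apply]; exact hlad k hk'
    have := AddSubgroup.add_mem _ hψf hψb
    rw [pow_succ', Module.End.mul_apply]
    convert this using 1
    rw [map_sub]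
    abel

/-- **Ladder generation.** Let `φ ∈ End_ℤ(A)`, `N ≤ A` `φ`-stable, `b : ℕ → A`, `e : ℕ` with: `b j ∈ N` for
`j ≥ e` (top), `φ(b k) − b k − b (k+1) ∈ ⟨b j : j ≥ k+2⟩ + N` for `k < e` (ladder), and `A = ⟨b k⟩ + N`
(span). Then `A = ⟨φ^i (b 0) : i ∈ ℕ⟩ + N`: the bottom rung generates `A` over `ℤ[φ]` modulo `N`.
(Abstract form of the tower lemma `(T_n)` for `𝒪_{ℚ₂(ζ_{2^{n+1}})⁺}` with the twisted Galois action,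
memo LAGPLUS-AT-2-CONSTRUCTION §4 (v).) [cite: Kobayashi2003, Props. 8.11–8.12 (pp. 17–18)]
[cite: AtiyahMacdonald1969, Prop. 2.6] -/
theorem mem_closure_pow_apply_sup (φ : Module.End ℤ A) (N : AddSubgroup A) (hN : ∀ x ∈ N, φ x ∈ N)
    (b : ℕ → A) (e : ℕ) (htop : ∀ j, e ≤ j → b j ∈ N)
    (hlad : ∀ k, k < e → φ (b k) - b k - b (k + 1) ∈ AddSubgroup.closure (b '' Set.Ici (k + 2)) ⊔ N)
    (hspan : ∀ a : A, a ∈ AddSubgroup.closure (Set.range b) ⊔ N) (a : A) :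
    a ∈ AddSubgroup.closure (Set.range fun i : ℕ ↦ (φ ^ i) (b 0)) ⊔ N := by
  set T : AddSubgroup A := AddSubgroup.closure (Set.range fun i : ℕ ↦ (φ ^ i) (b 0)) ⊔ N with hT_def
  -- `T` is `φ`-stable, hence `(φ − 1)^k`-stable
  have hTφ : ∀ x ∈ T, φ x ∈ T := by
    intro x hx
    obtain ⟨y, hy, n, hn, rfl⟩ := AddSubgroup.mem_sup.mp hx
    rw [map_add]
    refine AddSubgroup.add_mem _ ?_ (AddSubgroup.mem_sup_right (hN n hn))
    refine AddSubgroup.mem_sup_left ?_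
    refine AddSubgroup.closure_induction (p := fun y _ ↦ φ y ∈ AddSubgroup.closure (Set.range fun i : ℕ ↦ (φ ^ i) (b 0)))
      ?_ ?_ ?_ ?_ hy
    · rintro _ ⟨i, rfl⟩
      exact AddSubgroup.subset_closure ⟨i + 1, by simp only [pow_succ', Module.End.mul_apply]⟩
    · rw [map_zero]; exact AddSubgroup.zero_mem _
    · intro x y _ _ hx hy; rw [map_add]; exact AddSubgroup.add_mem _ hx hy
    · intro x _ hx; rw [map_neg]; exact AddSubgroup.neg_mem _ hx
  have hTψ : ∀ (k : ℕ), ∀ x ∈ T, ((φ - 1) ^ k) x ∈ T := by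
    intro k
    induction k with
    | zero => intro x hx; rwa [pow_zero, Module.End.one_apply]
    | succ k ih =>
      intro x hx
      rw [pow_succ', Module.End.mul_apply, LinearMap.sub_apply, Module.End.one_apply]
      exact T.sub_mem (hTφ _ (ih x hx)) (ih x hx)
  have hb0 : b 0 ∈ T :=
    AddSubgroup.mem_sup_left (AddSubgroup.subset_closure ⟨0, by simp only [pow_zero, Module.End.one_apply]⟩)
  -- downward induction: all rungs `b j`, `j ≥ k`, lie in `T`
  have hdown : ∀ m : ℕ, ∀ j, e - m ≤ j → b j ∈ T := by
    intro m
    induction m with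
    | zero => intro j hj; exact AddSubgroup.mem_sup_right (htop j (by omega))
    | succ m ih =>
      intro j hj
      by_cases hje : e - m ≤ j
      · exact ih j hje
      · -- `j = e − (m+1) < e`: `ψ^j b0 ∈ b j + F(j+1)` with `F(j+1) ⊆ T` by the induction hypothesis
        have hj' : j < e := by omega
        have hF : AddSubgroup.closure (b '' Set.Ici (j + 1)) ⊔ N ≤ T := by
          refine sup_le ((AddSubgroup.closure_le _).mpr ?_) le_sup_right
          rintro _ ⟨i, hi, rfl⟩
          exact ih i (by rw [Set.mem_Ici] at hi; omega)
        have h1 := hF (pow_sub_one_apply_sub_mem φ N hN b e htop hlad hj'.le)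
        have h2 := hTψ j (b 0) hb0
        have := T.sub_mem h2 h1
        rwa [sub_sub_cancel] at this
  have hall : ∀ j, b j ∈ T := fun j ↦ hdown e j (by omega)
  -- conclude from (span)
  obtain ⟨y, hy, n, hn, rfl⟩ := AddSubgroup.mem_sup.mp (hspan a)
  refine T.add_mem ?_ (AddSubgroup.mem_sup_right hn)
  exact (AddSubgroup.closure_le T).mpr (by rintro _ ⟨j, rfl⟩; exact hall j) hy

/-- **Nakayama iteration.** If a subgroup `S` generates `A` modulo `p`: every `a` is `s + p•a'`, then it
generates modulo every `p^k`. [cite: AtiyahMacdonald1969, Cor. 2.7] -/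
theorem exists_mem_add_pow_nsmul (S : AddSubgroup A) (p : ℕ) (h : ∀ a : A, ∃ s ∈ S, ∃ a' : A, a = s + p • a')
    (k : ℕ) (a : A) : ∃ s ∈ S, ∃ a' : A, a = s + p ^ k • a' := by
  induction k generalizing a with
  | zero => exact ⟨0, S.zero_mem, a, by rw [pow_zero, one_smul, zero_add]⟩
  | succ k ih =>
    obtain ⟨s, hs, a', rfl⟩ := ih a
    obtain ⟨s', hs', a'', rfl⟩ := h a'
    exact ⟨s + p ^ k • s', S.add_mem hs (S.nsmul_mem hs' _), a'',
      by rw [smul_add, ← mul_smul, ← pow_succ, add_assoc]⟩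

/-- **Ladder generation modulo `p^k`**: under the hypotheses of `mem_closure_pow_apply_sup` with
`N` the multiples of `p` (stated through congruences: top rungs and ladder defects are `p`-multiples),
every `a ∈ A` is congruent modulo `p^k·A` to an element of `⟨φ^i(b 0) : i⟩`, for every `k`.
[cite: Kobayashi2003, Props. 8.11–8.12] [cite: AtiyahMacdonald1969, Prop. 2.6, Cor. 2.7] -/
theorem exists_mem_closure_add_pow_nsmul (φ : Module.End ℤ A) (p : ℕ) (b : ℕ → A) (e : ℕ)
    (htop : ∀ j, e ≤ j → ∃ a' : A, b j = p • a')
    (hlad : ∀ k, k < e → ∃ f ∈ AddSubgroup.closure (b '' Set.Ici (k + 2)), ∃ a' : A,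
      φ (b k) - b k - b (k + 1) = f + p • a')
    (hspan : ∀ a : A, ∃ f ∈ AddSubgroup.closure (Set.range b), ∃ a' : A, a = f + p • a')
    (k : ℕ) (a : A) :
    ∃ s ∈ AddSubgroup.closure (Set.range fun i : ℕ ↦ (φ ^ i) (b 0)), ∃ a' : A, a = s + p ^ k • a' := by
  -- `N := p • A` as a subgroup (the range of multiplication by `p`)
  set N : AddSubgroup A := (nsmulAddMonoidHom (α := A) p).range with hN_def
  have hNmem : ∀ {x : A}, x ∈ N ↔ ∃ a' : A, x = p • a' := fun {x} ↦ by
    rw [hN_def, AddMonoidHom.mem_range]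
    exact ⟨fun ⟨a', h⟩ ↦ ⟨a', by rw [← h, nsmulAddMonoidHom_apply]⟩,
      fun ⟨a', h⟩ ↦ ⟨a', by rw [nsmulAddMonoidHom_apply, h]⟩⟩
  have hN : ∀ x ∈ N, φ x ∈ N := by
    intro x hx
    obtain ⟨a', rfl⟩ := hNmem.mp hx
    exact hNmem.mpr ⟨φ a', map_nsmul φ p a'⟩
  refine exists_mem_add_pow_nsmul _ p (fun a ↦ ?_) k a
  have hmem := mem_closure_pow_apply_sup φ N hN b e
    (fun j hj ↦ hNmem.mpr (htop j hj))
    (fun k hk ↦ by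
      obtain ⟨f, hf, a', h⟩ := hlad k hk
      rw [h]; exact AddSubgroup.add_mem _ (AddSubgroup.mem_sup_left hf) (AddSubgroup.mem_sup_right (hNmem.mpr ⟨a', rfl⟩)))
    (fun a ↦ by
      obtain ⟨f, hf, a', h⟩ := hspan a
      rw [h]; exact AddSubgroup.add_mem _ (AddSubgroup.mem_sup_left hf) (AddSubgroup.mem_sup_right (hNmem.mpr ⟨a', rfl⟩)))
    a
  obtain ⟨s, hs, n, hn, h⟩ := AddSubgroup.mem_sup.mp hmem
  obtain ⟨a', rfl⟩ := hNmem.mp hn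
  exact ⟨s, hs, a', h.symm⟩

end Summit.BirchSwinnertonDyer.BirchSwinnertonDyer.Theorems.SignedEC.Ladder

end
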